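import Summits.ABC.ABC.Theorems.IsogenyGlueCongruenceMazurKenkuBoundOfEightTables
import Literature.NumberTheory.EllipticCurves.KleinFrickeLevelSevenJZero
import Literature.NumberTheory.EllipticCurves.KleinFrickeLevelTwentySeven
import HarnessLib

/-!
# Route `IsogenyGlueCongruence`, child `KenkuCompositeTables` (stmt-ABC-18225) of the split crux
# `MazurKenkuBound` — CLOSED from three tree theorems

The `j`-tables of rational CYCLIC isogenies at the three composite tabulated levels `15, 21, 27`
(Kenku 1982 p. 200; Ligozat 1975): levels `15 = 3·5` and `21 = 3·7` are the tree theorems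
`levelFifteen_jTable`, `levelTwentyOne_jTable_of` (lead c22: fibre products of the Klein–Fricke covers
at `3, 5, 7` onto `15a1`, `21a1` and their Mordell–Weil groups; the Klein–Fricke-`7` input over `ℚ`
is supplied here from the axiom-clean tree theorems `Isogeny.exists_j_eq_klein_seven_of_degree_eq_seven`
and `Isogeny.j_ne_zero_of_degree_eq_seven_rat`), level `27` is
`Isogeny.j_eq_of_isCyclic_degree_twentySeven` (ccert g2, p171877: Klein–Fricke at `9` twice on the
`3`-quotient and Euler's case `n = 3` of Fermat). This file only re-sorts the rows.
[cite: Kenku1982, proof of Thm. 1, p. 200] [cite: Ligozat1975]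
-/

set_option linter.dupNamespace false

noncomputable section

open scoped Classical

open WeierstrassCurve
open Literature.NumberTheory.EllipticCurves

namespace Summit.ABC.ABC.Theorems

/-- The rows of `kenkuIsogenyJTable` at the levels `15, 21` are the eight tabulated pairs (finite
check). [cite: Kenku1982, proof of Thm. 1, p. 200] -/
theorem kenkuIsogenyJTable_rows_fifteen_twentyOne :
    ∀ r ∈ kenkuIsogenyJTable, r.1 = 15 ∨ r.1 = 21 →
      r ∈ ({((15 : ℕ), (-25 / 2 : ℚ)), (15, -349938025 / 8), (15, -121945 / 32),
        (15, 46969655 / 32768), (21, -140625 / 8), (21, 3375 / 2), (21, -1159088625 / 2097152),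
        (21, -189613868625 / 128), (27, -12288000)} : Finset (ℕ × ℚ)) := by
  decide +kernel

/-- **Child `KenkuCompositeTables` (stmt-ABC-18225) of the split crux `MazurKenkuBound`, proved**:
a cyclic rational isogeny of degree `15, 21` or `27` out of `V` forces `(deg, j(V))` into the nine
rows of Kenku's table at these levels — assembled from the tree theorems `levelFifteen_jTable`,
`levelTwentyOne_jTable_of` (fed with the axiom-clean Klein–Fricke-`7`-over-`ℚ` term) and
`Isogeny.j_eq_of_isCyclic_degree_twentySeven`.
[cite: Kenku1982, proof of Thm. 1, p. 200] [cite: Ligozat1975] -/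
theorem kenkuCompositeTables_proof :
    Summit.ABC.ABC.Theses.IsogenyGlueCongruence.KenkuCompositeTables := by
  intro V V' _ _ ψ hψ hmem
  have hsplit : ∀ n ∈ ({15, 21, 27} : Finset ℕ), n = 15 ∨ n = 21 ∨ n = 27 := by decide
  rcases hsplit _ hmem with h | h | h
  · have hT := levelFifteen_jTable V V' ψ hψ h
    rw [h]
    exact kenkuIsogenyJTable_rows_fifteen_twentyOne _ hT (Or.inl rfl)
  · have hT := levelTwentyOne_jTable_of
      (fun W W' _ φ h7 ↦ φ.exists_j_eq_klein_seven_of_degree_eq_seven h7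
        (φ.j_ne_zero_of_degree_eq_seven_rat h7)) V V' ψ hψ h
    rw [h]
    exact kenkuIsogenyJTable_rows_fifteen_twentyOne _ hT (Or.inr rfl)
  · rw [h, ψ.j_eq_of_isCyclic_degree_twentySeven hψ h]
    decide +kernel

end Summit.ABC.ABC.Theorems

end
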